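import Literature.Analysis.FluidPDE.LocalLerayWeakStrongNonmeasurableDatum
import Literature.Analysis.FluidPDE.LocalLerayDifferenceEnergy
import HarnessLib

/-!
# The tested local energy inequality for the difference of two local Leray solutions fails
for non-measurable data: refutation of the hypothesis `hA` of the reductions of **U₁**

Analysis/FluidPDE refutation file (theorems only, everything PROVED), companion of
`LocalLerayWeakStrongNonmeasurableDatum.lean` (which refutes the named fact
`local_leray_difference_energy_estimate`, **U₁**, transcribed from P. G. Lemarié-Rieusset,
*The Navier–Stokes Problem in the 21st Century* (2016), proof of Thm. 14.7, WITHOUT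
measurability of the datum).

The second layer of the tree's decomposition of **U₁** (`LocalLerayDifferenceEnergy.lean`,
`LocalLerayDifferenceRHS.lean`, `LocalLerayDifferenceTransport.lean`) reduces **U₁** to two
inline hypotheses over the setting `LemarieRieusset2016.WeakStrongSetting` — part 1 of the printed
proof, the **tested local energy inequality for `w = u₁ - u₂`** (pp. 515–516; hypothesis `hA` of
`local_leray_difference_energy_estimate_of`, `…_of_pressure_transport`,
`…_of_energyIneq_pressure`):

`½ ∫ φ|w(t)|² + ν ∫₀ᵗ∫ φ|∇w|² ≤ differenceEnergyRHS ν t u₁ u₂ p₁ p₂ G₁ G₂ φ` for a.e. `t ∈ (0,T)`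
and every nonnegative test function `φ`,

and the pressure estimates `hP`. The setting quantifies over an ARBITRARY datum `u₀ : ℝ³ → ℝ³`
(no measurability), exactly as **U₁** does. **This file proves that `hA` is false as stated** —
even in the weaker form "for every `φ`, for a.e. `t`" — so that those reductions are vacuous
until the datum is assumed measurable (`AEStronglyMeasurable u₀ volume`, i.e. the book's
`u₀ ∈ L²_uloc`, §14.1, p. 488), and it locates the printed step that needs measurability: the
initial layer `w(0) = 0`, i.e. "`∫_K |u₁(t) - u₂(t)|² → 0` as `t → 0⁺`", which follows from the two
clauses `∫⁻_K ‖uᵢ t - u₀‖ₑ² → 0` of `IsLocalLeraySolutionOn.initial` only through the triangle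
inequality for *measurable* integrands.

## The counterexample (the one of `LocalLerayWeakStrongNonmeasurableDatum.lean`)

`A ⊆ ℝ³` saturated non-measurable (Halmos 1950, §16 Thm. E), `θ = curl(η e₂) ≢ 0` smooth,
compactly supported and divergence free, `u₀ := 𝟙_A θ`; `u₁ := 0`, `p₁ := 0` (the "regular"
solution: `u₃ = u₄ = 0`, `m = 0`, `ε = 0`, `G₁ = 0`) and `u₂ :=` the Kato solution with datum `θ`
with its local Leray pressure `p₂` on `(0,S)` (Lemarié-Rieusset 2016, Thm. 15.1 (A);
`kato_isLocalLeraySolutionOn_holds`) and weak gradient `G₂`: BOTH are local Leray solutions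
with datum `u₀` (lower integrals do not see `A`), so all clauses of the setting hold
(`LocalLerayNonmeasurableDatum.exists_weakStrongSetting`). Test the inequality with the bump
`φ = φ₀(· - x⋆)`, `φ₀ = 1` on `B(0,1)`, at a point `x⋆` with `θ(x⋆) ≠ 0`:

* the left-hand side dominates `½ ∫_{B(x⋆,1)} |u₂(t)|²`, and since `∫_{B(x⋆,1)} |u₂(t) - θ|² → 0`
  (`u₂` attains its honest datum `θ`) while `c₀ = ∫_{B(x⋆,1)} |θ|² > 0`, it stays above `c₀/16`
  for all small `t > 0` (`|θ|² ≤ 4|u₂(t)|² + 4|u₂(t) - θ|²`);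
* the right-hand side is bounded by integrals over the shrinking cylinders `(0,t) × B(x⋆,R)` of
  three functions integrable on `(0,S) × B(x⋆,R)` — `|Δφ||u₂|²`, the pressure pairing
  `|p₂⟨u₂,∇φ⟩|` (`WeakStrongSetting.integrable_pressure_pairing`) and `|u₂|³|∇φ|`
  (`WeakStrongSetting.lintegral_cylinder_cube_lt_top`) — hence tends to `0` as `t → 0⁺`
  (absolute continuity, `tendsto_setLIntegral_zero`);

so the inequality fails on an initial time interval of positive measure
(`exists_of_ae_Ioo_of_eventually_nhdsGT`).

## Main results (all proved)

* `tendsto_lintegral_cylinder_nhdsGT_zero` — `∫⁻_{(0,t)×B} F → 0` as `t → 0⁺` when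
  `∫⁻_{(0,S)×B} F < ∞`, `|B| < ∞`;
* `LocalLerayNonmeasurableDatum.exists_weakStrongSetting` — the counterexample satisfies
  `LemarieRieusset2016.WeakStrongSetting`;
* `not_weakStrong_energyIneq` — **the tested local energy inequality for the difference is false
  over the setting without datum measurability** ("`∀ φ`, a.e. `t`" form);
* `not_weakStrong_energyIneq_ae_forall` — hence also in the form "a.e. `t`, `∀ φ`", which is
  literally hypothesis `hA` of `local_leray_difference_energy_estimate_of`,
  `local_leray_difference_energy_estimate_of_pressure_transport`,
  `local_leray_difference_energy_estimate_of_energyIneq_pressure` and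
  `local_leray_weak_strong_uniqueness_of_energyIneq_pressure`.

## Mathlib / tree search

Tree: `LemarieRieusset2016.WeakStrongSetting`, `weightedEnergy`, `weightedGradEnergyOn`,
`differenceEnergyRHS`, `exists_unit_bump`, `isTestFunctionOn_comp_sub_right`,
`exists_testFunction_translate_bounds`, `lintegral_ball_le_weightedEnergy`,
`WeakStrongSetting.integrable_pressure_pairing`, `WeakStrongSetting.lintegral_cylinder_cube_lt_top`
(`LocalLerayDifferenceEnergy`); `LocalLerayNonmeasurableDatum.memLp_θ`, `isWeaklyDivFree_θ`,
`integral_eq_zero_of_eq_zero_off_innerNull` (`LocalLerayWeakStrongNonmeasurableDatum`);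
`exists_of_ae_Ioo_of_eventually_nhdsGT` (`NSSereginMildStabilityTools`); `kato_local_holds`,
`kato_isLocalLeraySolutionOn_holds`, `IsKatoSolutionOn.memLp`, `isLocalLeraySolutionOn_zero`,
`hasWeakSpatialGradientOn_zero`; `exists_saturated_euclideanSpace`,
`lintegral_le_lintegral_of_innerNull`, `lintegral_eq_zero_of_innerNull`, `innerNull_restrict`.
Mathlib: `tendsto_setLIntegral_zero`, `Measure.prod_prod`, `Real.volume_Ioo`,
`enorm_integral_le_lintegral_enorm`, `measure_ball_pos`, `measure_ball_lt_top`,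
`Continuous.bounded_above_of_compact_support`, `ENNReal.Tendsto.const_mul`.

## References

* P. G. Lemarié-Rieusset, *The Navier–Stokes Problem in the 21st Century*, CRC Press 2016,
  doi:10.1201/b19556: §14.1 p. 488 (`L²_uloc`), Thm. 14.7 and its proof (pp. 514–518: the
  balance of `|w|²`, p. 515; the tested inequality, p. 516), Thm. 15.1 (A) (p. 565).
  [LemarieRieusset2016]
* P. R. Halmos, *Measure Theory* (1950), §16 Thm. E. [Halmos1950]
* T. Kato, Math. Z. 187 (1984), Thm. 1. [Kato1984]
-/

noncomputable section

open MeasureTheory TopologicalSpace Set Function Filter Topology Metric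
open scoped ENNReal NNReal RealInnerProductSpace Laplacian

namespace Literature.Analysis.FluidPDE

/-! ## Absolute continuity on shrinking cylinders -/

/-- **Integrals over the shrinking cylinders `(0,t) × B` tend to zero as `t → 0⁺`**, for a
function with finite integral on `(0,S) × B`, `S > 0`, `|B| < ∞` (absolute continuity of the
integral, `tendsto_setLIntegral_zero`, and `|(0,t) × B| = t|B| → 0`). [folklore] -/
theorem tendsto_lintegral_cylinder_nhdsGT_zero {X : Type*} [MeasureSpace X]
    {F : ℝ × X → ℝ≥0∞} {S : ℝ} (hS : 0 < S) {B : Set X} (hBm : MeasurableSet B)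
    (hB : volume B ≠ ∞) [SFinite (volume : Measure X)]
    (hF : ∫⁻ z in Ioo 0 S ×ˢ B, F z ≠ ∞) :
    Tendsto (fun t => ∫⁻ z in Ioo 0 t ×ˢ B, F z) (𝓝[>] 0) (𝓝 0) := by
  set μ : Measure (ℝ × X) := volume.restrict (Ioo 0 S ×ˢ B) with hμ
  -- the measures of the cylinders tend to zero
  have hvol : Tendsto (μ ∘ fun t => Ioo 0 t ×ˢ B) (𝓝[>] 0) (𝓝 0) := by
    have h0 : Tendsto (fun t : ℝ => ENNReal.ofReal t) (𝓝[>] 0) (𝓝 0) := by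
      have h := (ENNReal.continuous_ofReal.tendsto 0).mono_left (nhdsWithin_le_nhds (s := Ioi 0))
      simpa using h
    have h1 : Tendsto (fun t : ℝ => ENNReal.ofReal t * volume B) (𝓝[>] 0) (𝓝 0) := by
      have h := ENNReal.Tendsto.mul_const h0 (Or.inr hB)
      simpa using h
    refine tendsto_of_tendsto_of_tendsto_of_le_of_le tendsto_const_nhds h1 (fun _ => bot_le)
      fun t => ?_
    calc (μ ∘ fun t => Ioo 0 t ×ˢ B) t = μ (Ioo 0 t ×ˢ B) := rfl
      _ ≤ volume (Ioo (0 : ℝ) t ×ˢ B) := Measure.le_iff'.1 Measure.restrict_le_self _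
      _ = volume (Ioo (0 : ℝ) t) * volume B := by
          rw [Measure.volume_eq_prod, Measure.prod_prod]
      _ = ENNReal.ofReal t * volume B := by rw [Real.volume_Ioo, sub_zero]
  have h1 : Tendsto (fun t => ∫⁻ z in Ioo 0 t ×ˢ B, F z ∂μ) (𝓝[>] 0) (𝓝 0) :=
    tendsto_setLIntegral_zero (μ := μ) hF hvol
  -- for `0 < t < S` the restricted integral is the plain one
  have h2 : ∀ᶠ t in 𝓝[>] (0 : ℝ), ∫⁻ z in Ioo 0 t ×ˢ B, F z ∂μ = ∫⁻ z in Ioo 0 t ×ˢ B, F z := by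
    filter_upwards [Ioo_mem_nhdsGT hS] with t ht
    rw [hμ, Measure.restrict_restrict (measurableSet_Ioo.prod hBm),
      inter_eq_left.2 (prod_mono (Ioo_subset_Ioo_right ht.2.le) Subset.rfl)]
  exact h1.congr' h2

/-- `(a + b)² ≤ 4a² + 4b²` in `ℝ≥0∞` (crude, via `a + b ≤ 2 max(a,b)`). [folklore] -/
theorem ennreal_add_sq_le_four (a b : ℝ≥0∞) : (a + b) ^ 2 ≤ 4 * a ^ 2 + 4 * b ^ 2 := by
  have h1 : a + b ≤ 2 * max a b :=
    calc a + b ≤ max a b + max a b := add_le_add (le_max_left _ _) (le_max_right _ _)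
      _ = 2 * max a b := (two_mul _).symm
  have h2 : max a b ^ 2 ≤ a ^ 2 + b ^ 2 := by
    rcases le_total a b with h | h
    · rw [max_eq_right h]; exact le_add_self
    · rw [max_eq_left h]; exact le_self_add
  calc (a + b) ^ 2 ≤ (2 * max a b) ^ 2 := pow_le_pow_left' h1 2
    _ = 4 * max a b ^ 2 := by rw [mul_pow]; norm_num
    _ ≤ 4 * (a ^ 2 + b ^ 2) := mul_le_mul' le_rfl h2
    _ = 4 * a ^ 2 + 4 * b ^ 2 := mul_add _ _ _

/-! ## The counterexample satisfies the setting of Thm. 14.7 as transcribed -/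

namespace LocalLerayNonmeasurableDatum

open DistributionalToWeakCounterexample LemarieRieusset2016

/-- **The counterexample is a weak–strong setting.** There are `S > 0`, a Kato solution `u` with
datum `θ` on `[0,T)`, `T > S`, which with some pressure `p` is a local Leray solution with datum
`θ` on `(0,S)`, a weak gradient `G` of `u`, and a (non-measurable) datum `u₀` such that
`(ν, T, u₀, u₁, u₂, p₁, p₂, u₃, u₄, m, ε, G₁, G₂) = (1, S, u₀, 0, u, 0, p, 0, 0, 0, 0, 0, G)` satisfies
`LemarieRieusset2016.WeakStrongSetting` (module docstring). [cite: Halmos1950, §16 Theorem E (the saturated set); LemarieRieusset2016 Thm. 15.1 (A) (the Kato solution is a local Leray solution)] -/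
theorem exists_weakStrongSetting :
    ∃ (S T : ℝ) (u : ℝ → (EuclideanSpace ℝ (Fin 3)) → (EuclideanSpace ℝ (Fin 3))) (p : ℝ → (EuclideanSpace ℝ (Fin 3)) → ℝ) (G : ℝ → (EuclideanSpace ℝ (Fin 3)) → (EuclideanSpace ℝ (Fin 3)) →L[ℝ] (EuclideanSpace ℝ (Fin 3))) (u₀ : (EuclideanSpace ℝ (Fin 3)) → (EuclideanSpace ℝ (Fin 3))),
      0 < S ∧ S < T ∧ IsKatoSolutionOn T 1 θ u ∧ IsLocalLeraySolutionOn S 1 θ u p ∧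
      WeakStrongSetting 1 S u₀ 0 u 0 p 0 0 (fun _ => 0) 0 0 G := by
  -- the saturated set and the datum
  obtain ⟨A, hA, hAc⟩ := Literature.MeasureTheory.Lebesgue.exists_saturated_euclideanSpace 2
  set u₀ : (EuclideanSpace ℝ (Fin 3)) → (EuclideanSpace ℝ (Fin 3)) := A.indicator θ with hu₀
  have hu₀A : ∀ x ∈ A, u₀ x = θ x := fun x hx => indicator_of_mem hx θ
  have hu₀Ac : ∀ x, x ∉ A → u₀ x = 0 := fun x hx => indicator_of_notMem hx θ
  -- the Kato solution with datum `θ` and its local Leray structure on `(0, S)`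
  obtain ⟨T, hT, u, hmild, hcont, hinit, hmeas⟩ := kato_local_holds 1 one_pos θ memLp_θ
    isWeaklyDivFree_θ
  have hK : IsKatoSolutionOn T 1 θ u := ⟨hmild, hcont, hinit, hmeas⟩
  set S : ℝ := T / 2 with hS
  have hS0 : 0 < S := by positivity
  have hST : S < T := by simp only [hS]; linarith
  obtain ⟨p, hp⟩ := kato_isLocalLeraySolutionOn_holds 1 T θ u one_pos hK S hS0 hST
  -- `u` is a local Leray solution with datum `u₀` as well
  have h₂ : IsLocalLeraySolutionOn S 1 u₀ u p :=
    { hp with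
      initial := fun K hKc => by
        have hslice : ∀ t ∈ Ioo (0 : ℝ) T, ∫⁻ x in K, ‖u t x - u₀ x‖ₑ ^ 2 ≤
            ∫⁻ x in K, ‖u t x - θ x‖ₑ ^ 2 := by
          intro t ht
          have hmt : AEStronglyMeasurable (u t) volume := (hK.memLp ⟨ht.1.le, ht.2⟩).1
          refine Literature.MeasureTheory.Lebesgue.lintegral_le_lintegral_of_innerNull
            (Literature.MeasureTheory.Lebesgue.innerNull_restrict hAc K)
            ((hmt.sub θ_continuous.aestronglyMeasurable).enorm.pow_const 2).restrict
            fun x hx => ?_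
          rw [hu₀A x (not_notMem.1 hx)]
        refine tendsto_of_tendsto_of_tendsto_of_le_of_le' tendsto_const_nhds (hp.initial K hKc)
          (Eventually.of_forall fun t => bot_le) ?_
        filter_upwards [Ioo_mem_nhdsGT hT] with t ht
        exact hslice t ht }
  -- the zero flow is a local Leray solution with datum `u₀`
  have h₁ : IsLocalLeraySolutionOn S 1 u₀ (0 : ℝ → (EuclideanSpace ℝ (Fin 3)) → (EuclideanSpace ℝ (Fin 3))) (0 : ℝ → (EuclideanSpace ℝ (Fin 3)) → ℝ) :=
    { isLocalLeraySolutionOn_zero S 1 with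
      initial := fun K hKc => by
        have hzero : ∀ t : ℝ,
            ∫⁻ x in K, ‖(0 : ℝ → (EuclideanSpace ℝ (Fin 3)) → (EuclideanSpace ℝ (Fin 3))) t x - u₀ x‖ₑ ^ 2 = 0 := by
          intro t
          refine Literature.MeasureTheory.Lebesgue.lintegral_eq_zero_of_innerNull
            (Literature.MeasureTheory.Lebesgue.innerNull_restrict hA K) fun x hx => ?_
          simp [hu₀Ac x hx]
        simp only [hzero]
        exact tendsto_const_nhds }
  -- the hypotheses on the datum
  have huloc : ∃ C : ℝ≥0, ∀ x₀ : (EuclideanSpace ℝ (Fin 3)), ∫⁻ x in ball x₀ 1, ‖u₀ x‖ₑ ^ 2 ≤ C := by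
    refine ⟨0, fun x₀ => le_of_eq ?_⟩
    rw [ENNReal.coe_zero]
    refine Literature.MeasureTheory.Lebesgue.lintegral_eq_zero_of_innerNull
      (Literature.MeasureTheory.Lebesgue.innerNull_restrict hA _) fun x hx => ?_
    simp [hu₀Ac x hx]
  have hdiv : IsWeaklyDivFree u₀ := by
    intro ϑ _
    refine integral_eq_zero_of_eq_zero_off_innerNull hA fun x hx => ?_
    simp [hu₀Ac x hx]
  -- the weak gradient of the Kato solution
  obtain ⟨G, hG, hGb⟩ := hp.uniformLocalGradient
  refine ⟨S, T, u, p, G, u₀, hS0, hST, hK, hp, ?_⟩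
  exact
    { viscosity_pos := one_pos
      time_pos := hS0
      datum_uloc := huloc
      datum_divFree := hdiv
      sol₁ := h₁
      sol₂ := h₂
      split := Eventually.of_forall fun z => by simp [Function.uncurry_def]
      measurable₃ := aestronglyMeasurable_const
      sqIntegrable_majorant := by simp
      bound₃ := Eventually.of_forall fun t => by simp
      size_nonneg := le_rfl
      bound₄ := Eventually.of_forall fun t => by simp
      grad₁ := hasWeakSpatialGradientOn_zero _
      grad₂ := hG
      gradBound₁ := fun R _ => ⟨0, fun x₀ => by simp [frobeniusNormSq_zero]⟩
      gradBound₂ := hGb }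

/-- `∫_{B(x⋆,1)} ‖θ‖² > 0` at a point `x⋆` with `θ(x⋆) ≠ 0` (continuity). [folklore] -/
theorem lintegral_ball_θ_pos {x : (EuclideanSpace ℝ (Fin 3))} (hx : θ x ≠ 0) :
    0 < ∫⁻ y in ball x 1, ‖θ y‖ₑ ^ 2 := by
  have hpos : 0 < ‖θ x‖ / 2 := by positivity
  -- a ball on which `‖θ‖ ≥ ‖θ x‖/2`
  obtain ⟨δ, hδ, hδball⟩ := Metric.continuousAt_iff.1 θ_continuous.continuousAt (‖θ x‖ / 2) hpos
  set r : ℝ := min δ 1 with hr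
  have hr0 : 0 < r := lt_min hδ one_pos
  have hlow : ∀ y ∈ ball x r, ENNReal.ofReal (‖θ x‖ / 2) ^ 2 ≤ ‖θ y‖ₑ ^ 2 := by
    intro y hy
    have hy' : dist y x < δ := lt_of_lt_of_le (mem_ball.1 hy) (min_le_left _ _)
    have h1 : ‖θ y - θ x‖ < ‖θ x‖ / 2 := by
      rw [← dist_eq_norm]; exact hδball hy'
    have h2 : ‖θ x‖ / 2 ≤ ‖θ y‖ := by
      have := norm_sub_norm_le (θ x) (θ y)
      rw [← norm_neg, neg_sub] at h1
      linarith
    refine pow_le_pow_left' ?_ 2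
    rw [← ofReal_norm]
    exact ENNReal.ofReal_le_ofReal h2
  calc (0 : ℝ≥0∞) < ENNReal.ofReal (‖θ x‖ / 2) ^ 2 * volume (ball x r) := by
        refine ENNReal.mul_pos ?_ (measure_ball_pos volume x hr0).ne'
        exact pow_ne_zero 2 (ENNReal.ofReal_pos.2 hpos).ne'
    _ = ∫⁻ _ in ball x r, ENNReal.ofReal (‖θ x‖ / 2) ^ 2 := (setLIntegral_const _ _).symm
    _ ≤ ∫⁻ y in ball x r, ‖θ y‖ₑ ^ 2 := setLIntegral_mono' measurableSet_ball hlow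
    _ ≤ ∫⁻ y in ball x 1, ‖θ y‖ₑ ^ 2 := lintegral_mono_set (ball_subset_ball (min_le_right _ _))

/-- `∫_{B(x⋆,1)} ‖θ‖² < ∞` (`θ` is bounded). [folklore] -/
theorem lintegral_ball_θ_lt_top (x : (EuclideanSpace ℝ (Fin 3))) : ∫⁻ y in ball x 1, ‖θ y‖ₑ ^ 2 < ∞ := by
  obtain ⟨C, hC⟩ := θ_continuous.bounded_above_of_compact_support θ_hasCompactSupport
  calc ∫⁻ y in ball x 1, ‖θ y‖ₑ ^ 2 ≤ ∫⁻ _ in ball x 1, ENNReal.ofReal C ^ 2 := by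
        refine lintegral_mono fun y => pow_le_pow_left' ?_ 2
        rw [← ofReal_norm]
        exact ENNReal.ofReal_le_ofReal (hC y)
    _ = ENNReal.ofReal C ^ 2 * volume (ball x 1) := setLIntegral_const _ _
    _ < ∞ := ENNReal.mul_lt_top (ENNReal.pow_lt_top ENNReal.ofReal_lt_top) measure_ball_lt_top

end LocalLerayNonmeasurableDatum

/-! ## The refutation -/

open LemarieRieusset2016 in
/-- **The tested local energy inequality for the difference of two local Leray solutions
(Lemarié-Rieusset 2016, proof of Thm. 14.7, pp. 515–516) is FALSE over the setting
`LemarieRieusset2016.WeakStrongSetting` as transcribed, i.e. without measurability of the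
datum** — already in the weak form "for every nonnegative test function `φ`, for a.e.
`t ∈ (0,T)`". Counterexample and proof: module docstring. The printed derivation uses
`w(0) = 0` in `L²_loc`, which needs `u₀` measurable (`u₀ ∈ L²_uloc`).
[cite: LemarieRieusset2016, Thm. 14.7, proof (file pp. 515–516), first display — false without the measurability of u₀; Halmos1950, §16 Theorem E] -/
theorem not_weakStrong_energyIneq :
    ¬ (∀ {ν T : ℝ} {u₀ : (EuclideanSpace ℝ (Fin 3)) → (EuclideanSpace ℝ (Fin 3))} {u₁ u₂ : ℝ → (EuclideanSpace ℝ (Fin 3)) → (EuclideanSpace ℝ (Fin 3))} {p₁ p₂ : ℝ → (EuclideanSpace ℝ (Fin 3)) → ℝ}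
        {u₃ u₄ : ℝ → (EuclideanSpace ℝ (Fin 3)) → (EuclideanSpace ℝ (Fin 3))} {m : ℝ → ℝ} {ε : ℝ} {G₁ G₂ : ℝ → (EuclideanSpace ℝ (Fin 3)) → (EuclideanSpace ℝ (Fin 3)) →L[ℝ] (EuclideanSpace ℝ (Fin 3))},
        WeakStrongSetting ν T u₀ u₁ u₂ p₁ p₂ u₃ u₄ m ε G₁ G₂ →
        ∀ φ : (EuclideanSpace ℝ (Fin 3)) → ℝ, FunctionSpaces.IsTestFunctionOn (⊤ : Opens (EuclideanSpace ℝ (Fin 3))) φ → (∀ x, 0 ≤ φ x) →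
        ∀ᵐ t ∂(volume.restrict (Ioo 0 T)),
          2⁻¹ * weightedEnergy φ (u₁ t - u₂ t) +
              ENNReal.ofReal ν * weightedGradEnergyOn t φ (G₁ - G₂) ≤
            differenceEnergyRHS ν t u₁ u₂ p₁ p₂ G₁ G₂ φ) := by
  intro H
  obtain ⟨S, T, u, p, G, u₀, hS0, hST, hK, hp, hWS⟩ :=
    LocalLerayNonmeasurableDatum.exists_weakStrongSetting
  have hT : 0 < T := hS0.trans hST
  -- the bump at a point where `θ ≠ 0`
  obtain ⟨xs, hxs⟩ := DistributionalToWeakCounterexample.exists_θ_ne_zero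
  obtain ⟨φ₀, hφ₀, hφ₀nn, hφ₀one⟩ := exists_unit_bump
  have hφ : FunctionSpaces.IsTestFunctionOn (⊤ : Opens (EuclideanSpace ℝ (Fin 3))) fun x => φ₀ (x - xs) :=
    isTestFunctionOn_comp_sub_right hφ₀ xs
  have key := H hWS (fun x => φ₀ (x - xs)) hφ (fun x => hφ₀nn _)
  obtain ⟨R, B, hR, hB, hbd⟩ := exists_testFunction_translate_bounds hφ₀
  -- ## the positive quantity `c₀ = ∫_{B(x⋆,1)} |θ|²`
  set c₀ : ℝ≥0∞ := ∫⁻ y in ball xs 1, ‖DistributionalToWeakCounterexample.θ y‖ₑ ^ 2 with hc₀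
  have hc₀pos : 0 < c₀ := LocalLerayNonmeasurableDatum.lintegral_ball_θ_pos hxs
  have hc₀top : c₀ ≠ ∞ := (LocalLerayNonmeasurableDatum.lintegral_ball_θ_lt_top xs).ne
  -- the threshold `κ = c₀ / 2 / 4 / 2`
  set κ : ℝ≥0∞ := c₀ / 2 / 4 / 2 with hκ
  have h2top : c₀ / 2 ≠ ∞ := ENNReal.div_ne_top hc₀top two_ne_zero
  have hκpos : 0 < κ := by
    simp only [hκ]
    refine ENNReal.div_pos (ENNReal.div_pos (ENNReal.div_pos hc₀pos.ne' ?_).ne' ?_).ne' ?_ <;>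
      simp
  -- ## the left-hand side stays above `κ` for small `t`
  set a : ℝ → ℝ≥0∞ := fun t => ∫⁻ y in ball xs 1, ‖u t y‖ₑ ^ 2 with ha
  set b : ℝ → ℝ≥0∞ := fun t =>
    ∫⁻ y in ball xs 1, ‖u t y - DistributionalToWeakCounterexample.θ y‖ₑ ^ 2 with hb
  have hb0 : Tendsto b (𝓝[>] 0) (𝓝 0) :=
    tendsto_of_tendsto_of_tendsto_of_le_of_le tendsto_const_nhds
      (hp.initial (closedBall xs 1) (isCompact_closedBall _ _)) (fun _ => bot_le)
      fun t => lintegral_mono_set ball_subset_closedBall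
  have hb4 : ∀ᶠ t in 𝓝[>] (0 : ℝ), 4 * b t < c₀ / 2 := by
    have h4 : Tendsto (fun t => 4 * b t) (𝓝[>] 0) (𝓝 0) := by
      have h := ENNReal.Tendsto.const_mul hb0 (Or.inr (by simp : (4 : ℝ≥0∞) ≠ ∞))
      simpa using h
    exact (tendsto_order.1 h4).2 _ (ENNReal.div_pos hc₀pos.ne' (by simp))
  have hLHS : ∀ᶠ t in 𝓝[>] (0 : ℝ), κ ≤ 2⁻¹ * a t := by
    filter_upwards [hb4, Ioo_mem_nhdsGT hT] with t ht4 htT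
    have hmt : AEStronglyMeasurable (u t) volume := (hK.memLp ⟨htT.1.le, htT.2⟩).1
    -- `c₀ ≤ 4 a(t) + 4 b(t)`
    have hpt : ∀ y, ‖DistributionalToWeakCounterexample.θ y‖ₑ ^ 2 ≤
        4 * ‖u t y‖ₑ ^ 2 + 4 * ‖u t y - DistributionalToWeakCounterexample.θ y‖ₑ ^ 2 := by
      intro y
      have h1 : ‖DistributionalToWeakCounterexample.θ y‖ₑ ≤
          ‖u t y‖ₑ + ‖u t y - DistributionalToWeakCounterexample.θ y‖ₑ :=
        calc ‖DistributionalToWeakCounterexample.θ y‖ₑ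
            = ‖u t y - (u t y - DistributionalToWeakCounterexample.θ y)‖ₑ := by rw [sub_sub_cancel]
          _ ≤ ‖u t y‖ₑ + ‖u t y - DistributionalToWeakCounterexample.θ y‖ₑ := enorm_sub_le
      exact (pow_le_pow_left' h1 2).trans (ennreal_add_sq_le_four _ _)
    have hmeas : AEMeasurable (fun y => 4 * ‖u t y‖ₑ ^ 2) (volume.restrict (ball xs 1)) :=
      ((hmt.enorm.pow_const 2).const_mul 4).restrict
    have hsum : c₀ ≤ 4 * a t + 4 * b t :=
      calc c₀ ≤ ∫⁻ y in ball xs 1,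
            (4 * ‖u t y‖ₑ ^ 2 + 4 * ‖u t y - DistributionalToWeakCounterexample.θ y‖ₑ ^ 2) :=
            lintegral_mono fun y => hpt y
        _ = 4 * a t + 4 * b t := by
            rw [lintegral_add_left' hmeas, lintegral_const_mul' _ _ (by simp),
              lintegral_const_mul' _ _ (by simp)]
    -- hence `c₀ / 2 ≤ 4 a(t)` and `κ ≤ a(t) / 2`
    have h3 : c₀ / 2 + c₀ / 2 ≤ 4 * a t + c₀ / 2 :=
      calc c₀ / 2 + c₀ / 2 = c₀ := ENNReal.add_halves c₀
        _ ≤ 4 * a t + 4 * b t := hsum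
        _ ≤ 4 * a t + c₀ / 2 := add_le_add le_rfl ht4.le
    have h4 : c₀ / 2 ≤ 4 * a t := ENNReal.le_of_add_le_add_right h2top h3
    have h5 : c₀ / 2 / 4 ≤ a t := by
      rw [ENNReal.div_le_iff (by simp) (by simp), mul_comm]
      exact h4
    calc κ = c₀ / 2 / 4 / 2 := rfl
      _ ≤ a t / 2 := ENNReal.div_le_div_right h5 2
      _ = 2⁻¹ * a t := by rw [ENNReal.div_eq_inv_mul]
  -- ## the right-hand side tends to zero
  -- the three integrable majorants on the cylinder `(0,S) × B(x⋆,R)`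
  set f₁ : ℝ × (EuclideanSpace ℝ (Fin 3)) → ℝ≥0∞ := fun z => ENNReal.ofReal (1 / 2) * ENNReal.ofReal B * ‖u z.1 z.2‖ₑ ^ 2
    with hf₁
  set P : ℝ × (EuclideanSpace ℝ (Fin 3)) → ℝ := fun z => ((0 : ℝ → (EuclideanSpace ℝ (Fin 3)) → ℝ) z.1 z.2 - p z.1 z.2) *
    ⟪(0 : ℝ → (EuclideanSpace ℝ (Fin 3)) → (EuclideanSpace ℝ (Fin 3))) z.1 z.2 - u z.1 z.2, gradient (fun x => φ₀ (x - xs)) z.2⟫ with hP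
  set f₂ : ℝ × (EuclideanSpace ℝ (Fin 3)) → ℝ≥0∞ := fun z => ‖P z‖ₑ with hf₂
  set f₄ : ℝ × (EuclideanSpace ℝ (Fin 3)) → ℝ≥0∞ := fun z => 2⁻¹ * ENNReal.ofReal B * ‖u z.1 z.2‖ₑ ^ 3 with hf₄
  set Φ : ℝ → ℝ≥0∞ := fun t => (∫⁻ z in Ioo 0 t ×ˢ ball xs R, f₁ z) +
    (∫⁻ z in Ioo 0 t ×ˢ ball xs R, f₂ z) + ∫⁻ z in Ioo 0 t ×ˢ ball xs R, f₄ z with hΦ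
  -- finiteness on `(0,S) × B(x⋆,R)`
  have hcylS : Ioo (0 : ℝ) S ×ˢ ball xs R ⊆ Ioo 0 S ×ˢ closedBall xs R :=
    prod_mono Subset.rfl ball_subset_closedBall
  have hF₁ : ∫⁻ z in Ioo 0 S ×ˢ ball xs R, f₁ z ≠ ∞ := by
    simp only [hf₁]
    rw [lintegral_const_mul' _ _ (ENNReal.mul_ne_top ENNReal.ofReal_ne_top ENNReal.ofReal_ne_top)]
    refine ENNReal.mul_ne_top (ENNReal.mul_ne_top ENNReal.ofReal_ne_top ENNReal.ofReal_ne_top) ?_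
    exact (lt_of_le_of_lt (lintegral_mono_set hcylS)
      (hp.sqIntegrable (closedBall xs R) (isCompact_closedBall _ _))).ne
  have hF₂ : ∫⁻ z in Ioo 0 S ×ˢ ball xs R, f₂ z ≠ ∞ := by
    have hint := hWS.integrable_pressure_pairing hφ₀ xs (t := S) le_rfl
    have hfin := hint.hasFiniteIntegral
    rw [hasFiniteIntegral_iff_enorm] at hfin
    exact (lt_of_le_of_lt (lintegral_mono_set (prod_mono Subset.rfl (subset_univ _))) hfin).ne
  have hF₄ : ∫⁻ z in Ioo 0 S ×ˢ ball xs R, f₄ z ≠ ∞ := by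
    simp only [hf₄]
    rw [lintegral_const_mul' _ _ (ENNReal.mul_ne_top (by simp) ENNReal.ofReal_ne_top)]
    refine ENNReal.mul_ne_top (ENNReal.mul_ne_top (by simp) ENNReal.ofReal_ne_top) ?_
    have h3 := hWS.lintegral_cylinder_cube_lt_top (t := S) le_rfl xs R
    have e : ∫⁻ z in Ioo 0 S ×ˢ ball xs R, ‖u z.1 z.2‖ₑ ^ 3 =
        ∫⁻ z in Ioo 0 S ×ˢ ball xs R, ‖(0 : ℝ → (EuclideanSpace ℝ (Fin 3)) → (EuclideanSpace ℝ (Fin 3))) z.1 z.2 - u z.1 z.2‖ₑ ^ 3 :=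
      lintegral_congr fun z => by simp
    rw [e]
    exact h3.ne
  have hΦ0 : Tendsto Φ (𝓝[>] 0) (𝓝 0) := by
    have hvol : volume (ball xs R) ≠ ∞ := measure_ball_lt_top.ne
    have h1 := tendsto_lintegral_cylinder_nhdsGT_zero hS0 measurableSet_ball hvol hF₁
    have h2 := tendsto_lintegral_cylinder_nhdsGT_zero hS0 measurableSet_ball hvol hF₂
    have h4 := tendsto_lintegral_cylinder_nhdsGT_zero hS0 measurableSet_ball hvol hF₄
    have h := (h1.add h2).add h4
    simpa using h
  have hRHSsmall : ∀ᶠ t in 𝓝[>] (0 : ℝ), Φ t < κ := (tendsto_order.1 hΦ0).2 _ hκpos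
  -- the right-hand side is dominated by `Φ`
  have hstrip : ∀ t : ℝ, MeasurableSet (Ioo (0 : ℝ) t ×ˢ (univ : Set (EuclideanSpace ℝ (Fin 3)))) := fun t =>
    measurableSet_Ioo.prod MeasurableSet.univ
  have hcyl : ∀ t : ℝ, MeasurableSet (Ioo (0 : ℝ) t ×ˢ ball xs R) := fun t =>
    measurableSet_Ioo.prod measurableSet_ball
  -- reduction of a strip integral to the cylinder, for integrands vanishing off the ball
  have hreduce : ∀ (t : ℝ) (f g : ℝ × (EuclideanSpace ℝ (Fin 3)) → ℝ≥0∞),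
      (∀ z, z.2 ∈ ball xs R → f z ≤ g z) → (∀ z, z.2 ∉ ball xs R → f z = 0) →
      ∫⁻ z in Ioo 0 t ×ˢ (univ : Set (EuclideanSpace ℝ (Fin 3))), f z ≤ ∫⁻ z in Ioo 0 t ×ˢ ball xs R, g z := by
    intro t f g hfg hf0
    calc ∫⁻ z in Ioo 0 t ×ˢ (univ : Set (EuclideanSpace ℝ (Fin 3))), f z
        ≤ ∫⁻ z in Ioo 0 t ×ˢ (univ : Set (EuclideanSpace ℝ (Fin 3))), (Ioo (0 : ℝ) t ×ˢ ball xs R).indicator g z := by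
          refine setLIntegral_mono' (hstrip t) fun z hz => ?_
          by_cases hzR : z.2 ∈ ball xs R
          · rw [indicator_of_mem (show z ∈ Ioo (0 : ℝ) t ×ˢ ball xs R from ⟨hz.1, hzR⟩)]
            exact hfg z hzR
          · rw [hf0 z hzR]
            exact bot_le
      _ = ∫⁻ z in Ioo 0 t ×ˢ ball xs R, g z := by
          rw [lintegral_indicator (hcyl t), Measure.restrict_restrict (hcyl t),
            inter_eq_left.2 (prod_mono Subset.rfl (subset_univ _))]
  have hinner : ∀ v w : (EuclideanSpace ℝ (Fin 3)), ‖⟪v, w⟫‖ₑ ≤ ‖v‖ₑ * ‖w‖ₑ := fun v w => by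
    rw [Real.enorm_eq_ofReal_abs, ← ofReal_norm, ← ofReal_norm, ← ENNReal.ofReal_mul (norm_nonneg _)]
    exact ENNReal.ofReal_le_ofReal (abs_real_inner_le_norm _ _)
  have hgradB : ∀ x : (EuclideanSpace ℝ (Fin 3)), ‖gradient (fun y => φ₀ (y - xs)) x‖ₑ ≤ ENNReal.ofReal B := fun x => by
    rw [← ofReal_norm]
    exact ENNReal.ofReal_le_ofReal (hbd xs x).2.1
  have hRHS : ∀ t : ℝ, differenceEnergyRHS 1 t 0 u 0 p 0 G (fun x => φ₀ (x - xs)) ≤ Φ t := by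
    intro t
    -- term 1: the Laplacian term
    have hT1 : (∫⁻ z in Ioo 0 t ×ˢ (univ : Set (EuclideanSpace ℝ (Fin 3))),
        ENNReal.ofReal (1 / 2) * ‖(Δ fun x => φ₀ (x - xs)) z.2‖ₑ *
          ‖(0 : ℝ → (EuclideanSpace ℝ (Fin 3)) → (EuclideanSpace ℝ (Fin 3))) z.1 z.2 - u z.1 z.2‖ₑ ^ 2) ≤
        ∫⁻ z in Ioo 0 t ×ˢ ball xs R, f₁ z := by
      refine hreduce t _ _ (fun z _ => ?_) (fun z hz => ?_)
      · have hΔ : ‖(Δ fun x => φ₀ (x - xs)) z.2‖ₑ ≤ ENNReal.ofReal B := by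
          rw [Real.enorm_eq_ofReal_abs]
          exact ENNReal.ofReal_le_ofReal (hbd xs z.2).2.2.1
        have e : ‖(0 : ℝ → (EuclideanSpace ℝ (Fin 3)) → (EuclideanSpace ℝ (Fin 3))) z.1 z.2 - u z.1 z.2‖ₑ = ‖u z.1 z.2‖ₑ := by simp
        rw [e]
        simp only [hf₁]
        gcongr
      · rw [((hbd xs z.2).2.2.2 hz).2.2]
        simp
    -- term 2: the pressure pairing
    have hT2 : ‖∫ z in Ioo 0 t ×ˢ (univ : Set (EuclideanSpace ℝ (Fin 3))),
        ((0 : ℝ → (EuclideanSpace ℝ (Fin 3)) → ℝ) z.1 z.2 - p z.1 z.2) *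
          ⟪(0 : ℝ → (EuclideanSpace ℝ (Fin 3)) → (EuclideanSpace ℝ (Fin 3))) z.1 z.2 - u z.1 z.2, gradient (fun x => φ₀ (x - xs)) z.2⟫‖ₑ ≤
        ∫⁻ z in Ioo 0 t ×ˢ ball xs R, f₂ z := by
      refine (enorm_integral_le_lintegral_enorm _).trans ?_
      refine hreduce t _ _ (fun z _ => le_rfl) (fun z hz => ?_)
      rw [((hbd xs z.2).2.2.2 hz).2.1, inner_zero_right, mul_zero, enorm_zero]
    -- term 4: the cubic transport term
    have hT4 : (∫⁻ z in Ioo 0 t ×ˢ (univ : Set (EuclideanSpace ℝ (Fin 3))),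
        2⁻¹ * ‖(0 : ℝ → (EuclideanSpace ℝ (Fin 3)) → (EuclideanSpace ℝ (Fin 3))) z.1 z.2 - u z.1 z.2‖ₑ ^ 2 *
          ‖⟪(0 : ℝ → (EuclideanSpace ℝ (Fin 3)) → (EuclideanSpace ℝ (Fin 3))) z.1 z.2 - u z.1 z.2, gradient (fun x => φ₀ (x - xs)) z.2⟫‖ₑ) ≤
        ∫⁻ z in Ioo 0 t ×ˢ ball xs R, f₄ z := by
      refine hreduce t _ _ (fun z _ => ?_) (fun z hz => ?_)
      · have e : ‖(0 : ℝ → (EuclideanSpace ℝ (Fin 3)) → (EuclideanSpace ℝ (Fin 3))) z.1 z.2 - u z.1 z.2‖ₑ = ‖u z.1 z.2‖ₑ := by simp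
        have hi : ‖⟪(0 : ℝ → (EuclideanSpace ℝ (Fin 3)) → (EuclideanSpace ℝ (Fin 3))) z.1 z.2 - u z.1 z.2, gradient (fun x => φ₀ (x - xs)) z.2⟫‖ₑ ≤
            ‖u z.1 z.2‖ₑ * ENNReal.ofReal B :=
          (hinner _ _).trans (by rw [e]; exact mul_le_mul' le_rfl (hgradB z.2))
        calc 2⁻¹ * ‖(0 : ℝ → (EuclideanSpace ℝ (Fin 3)) → (EuclideanSpace ℝ (Fin 3))) z.1 z.2 - u z.1 z.2‖ₑ ^ 2 *
              ‖⟪(0 : ℝ → (EuclideanSpace ℝ (Fin 3)) → (EuclideanSpace ℝ (Fin 3))) z.1 z.2 - u z.1 z.2, gradient (fun x => φ₀ (x - xs)) z.2⟫‖ₑ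
            ≤ 2⁻¹ * ‖u z.1 z.2‖ₑ ^ 2 * (‖u z.1 z.2‖ₑ * ENNReal.ofReal B) := by
              rw [e]; exact mul_le_mul' le_rfl hi
          _ = f₄ z := by simp only [hf₄]; ring
      · rw [((hbd xs z.2).2.2.2 hz).2.1, inner_zero_right, enorm_zero, mul_zero]
    -- terms 3, 5, 6 vanish (`u₁ = 0`)
    have hT3 : (∫⁻ z in Ioo 0 t ×ˢ (univ : Set (EuclideanSpace ℝ (Fin 3))),
        ‖⟪(0 : ℝ → (EuclideanSpace ℝ (Fin 3)) → (EuclideanSpace ℝ (Fin 3))) z.1 z.2, (0 : ℝ → (EuclideanSpace ℝ (Fin 3)) → (EuclideanSpace ℝ (Fin 3))) z.1 z.2 - u z.1 z.2⟫‖ₑ *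
          ‖⟪(0 : ℝ → (EuclideanSpace ℝ (Fin 3)) → (EuclideanSpace ℝ (Fin 3))) z.1 z.2 - u z.1 z.2, gradient (fun x => φ₀ (x - xs)) z.2⟫‖ₑ) = 0 := by
      simp
    have hT5 : (∫⁻ z in Ioo 0 t ×ˢ (univ : Set (EuclideanSpace ℝ (Fin 3))),
        2⁻¹ * ‖(0 : ℝ → (EuclideanSpace ℝ (Fin 3)) → (EuclideanSpace ℝ (Fin 3))) z.1 z.2 - u z.1 z.2‖ₑ ^ 2 *
          ‖⟪(0 : ℝ → (EuclideanSpace ℝ (Fin 3)) → (EuclideanSpace ℝ (Fin 3))) z.1 z.2, gradient (fun x => φ₀ (x - xs)) z.2⟫‖ₑ) = 0 := by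
      simp
    have hT6 : (∫⁻ z in Ioo 0 t ×ˢ (univ : Set (EuclideanSpace ℝ (Fin 3))),
        ENNReal.ofReal (φ₀ (z.2 - xs)) *
          ‖⟪(0 : ℝ → (EuclideanSpace ℝ (Fin 3)) → (EuclideanSpace ℝ (Fin 3))) z.1 z.2,
            ((0 : ℝ → (EuclideanSpace ℝ (Fin 3)) → (EuclideanSpace ℝ (Fin 3)) →L[ℝ] (EuclideanSpace ℝ (Fin 3))) z.1 z.2 - G z.1 z.2)
              ((0 : ℝ → (EuclideanSpace ℝ (Fin 3)) → (EuclideanSpace ℝ (Fin 3))) z.1 z.2 - u z.1 z.2)⟫‖ₑ) = 0 := by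
      simp
    unfold differenceEnergyRHS
    rw [hT3, hT5, hT6, add_zero, add_zero, add_zero]
    have e1 : ENNReal.ofReal ((1 : ℝ) / 2) = ENNReal.ofReal (1 / 2) := rfl
    exact add_le_add (add_le_add hT1 hT2) hT4
  -- ## contradiction on an initial interval of positive measure
  have hev : ∀ᶠ t in 𝓝[>] (0 : ℝ), κ ≤ 2⁻¹ * a t ∧ Φ t < κ := hLHS.and hRHSsmall
  obtain ⟨t, -, hkey, hκa, hΦt⟩ := exists_of_ae_Ioo_of_eventually_nhdsGT hS0 key hev
  -- the left-hand side at `t` dominates `a(t)/2`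
  have hone : ∀ x ∈ ball xs 1, (1 : ℝ) ≤ φ₀ (x - xs) := fun x hx => by
    rw [hφ₀one (x - xs) (by simpa [mem_ball, dist_eq_norm] using hx)]
  have hwE : a t ≤ weightedEnergy (fun x => φ₀ (x - xs)) ((0 : ℝ → (EuclideanSpace ℝ (Fin 3)) → (EuclideanSpace ℝ (Fin 3))) t - u t) := by
    have h := lintegral_ball_le_weightedEnergy hone ((0 : ℝ → (EuclideanSpace ℝ (Fin 3)) → (EuclideanSpace ℝ (Fin 3))) t - u t)
    have e : ∫⁻ x in ball xs 1, ‖((0 : ℝ → (EuclideanSpace ℝ (Fin 3)) → (EuclideanSpace ℝ (Fin 3))) t - u t) x‖ₑ ^ 2 = a t :=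
      lintegral_congr fun x => by simp
    rw [e] at h
    exact h
  have hchain : κ ≤ Φ t :=
    calc κ ≤ 2⁻¹ * a t := hκa
      _ ≤ 2⁻¹ * weightedEnergy (fun x => φ₀ (x - xs)) ((0 : ℝ → (EuclideanSpace ℝ (Fin 3)) → (EuclideanSpace ℝ (Fin 3))) t - u t) :=
          mul_le_mul' le_rfl hwE
      _ ≤ 2⁻¹ * weightedEnergy (fun x => φ₀ (x - xs)) ((0 : ℝ → (EuclideanSpace ℝ (Fin 3)) → (EuclideanSpace ℝ (Fin 3))) t - u t) +
            ENNReal.ofReal 1 * weightedGradEnergyOn t (fun x => φ₀ (x - xs))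
              ((0 : ℝ → (EuclideanSpace ℝ (Fin 3)) → (EuclideanSpace ℝ (Fin 3)) →L[ℝ] (EuclideanSpace ℝ (Fin 3))) - G) := le_self_add
      _ ≤ differenceEnergyRHS 1 t 0 u 0 p 0 G (fun x => φ₀ (x - xs)) := hkey
      _ ≤ Φ t := hRHS t
  exact absurd (lt_of_le_of_lt hchain hΦt) (lt_irrefl _)

open LemarieRieusset2016 in
/-- **Hypothesis `hA` of the tree's reductions of U₁ is unsatisfiable as stated.** The form
"for a.e. `t`, for all nonnegative test functions `φ`" of the tested local energy inequality
over `LemarieRieusset2016.WeakStrongSetting` — verbatim the hypothesis `hA` of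
`local_leray_difference_energy_estimate_of` (`LocalLerayDifferenceEnergy.lean`),
`local_leray_difference_energy_estimate_of_pressure_transport` (`LocalLerayDifferenceRHS.lean`),
`local_leray_difference_energy_estimate_of_energyIneq_pressure` and
`local_leray_weak_strong_uniqueness_of_energyIneq_pressure`
(`LocalLerayDifferenceTransport.lean`) — is false (it implies the weaker form refuted by
`not_weakStrong_energyIneq`). Those reductions therefore remain vacuous until the datum of the
setting is assumed measurable. [cite: LemarieRieusset2016, Thm. 14.7, proof (file pp. 515–516) — false without the measurability of u₀] -/
theorem not_weakStrong_energyIneq_ae_forall :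
    ¬ (∀ {ν T : ℝ} {u₀ : (EuclideanSpace ℝ (Fin 3)) → (EuclideanSpace ℝ (Fin 3))} {u₁ u₂ : ℝ → (EuclideanSpace ℝ (Fin 3)) → (EuclideanSpace ℝ (Fin 3))} {p₁ p₂ : ℝ → (EuclideanSpace ℝ (Fin 3)) → ℝ}
        {u₃ u₄ : ℝ → (EuclideanSpace ℝ (Fin 3)) → (EuclideanSpace ℝ (Fin 3))} {m : ℝ → ℝ} {ε : ℝ} {G₁ G₂ : ℝ → (EuclideanSpace ℝ (Fin 3)) → (EuclideanSpace ℝ (Fin 3)) →L[ℝ] (EuclideanSpace ℝ (Fin 3))},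
        WeakStrongSetting ν T u₀ u₁ u₂ p₁ p₂ u₃ u₄ m ε G₁ G₂ →
        ∀ᵐ t ∂(volume.restrict (Ioo 0 T)), ∀ φ : (EuclideanSpace ℝ (Fin 3)) → ℝ,
          FunctionSpaces.IsTestFunctionOn (⊤ : Opens (EuclideanSpace ℝ (Fin 3))) φ → (∀ x, 0 ≤ φ x) →
          2⁻¹ * weightedEnergy φ (u₁ t - u₂ t) +
              ENNReal.ofReal ν * weightedGradEnergyOn t φ (G₁ - G₂) ≤
            differenceEnergyRHS ν t u₁ u₂ p₁ p₂ G₁ G₂ φ) :=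
  fun H => not_weakStrong_energyIneq fun hS φ hφ hφ0 => (H hS).mono fun _ ht => ht φ hφ hφ0

end Literature.Analysis.FluidPDE
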